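import Literature.Geometry.Lorentzian.KerrRadiusGradientVector
import Literature.Geometry.Lorentzian.KerrSchildTimeTranslation
import Literature.Geometry.Lorentzian.KerrCylinderVacuum
import Literature.Geometry.Lorentzian.KerrCylinderParameterClosenessK
import Summits.FinalStateConjecture.FinalStateConjecture.Theorems.BartnikGapSettlingGapExhaustionKerrBilinCoerciveUniform
import HarnessLib

/-!
# `KerrEscapeFieldsUniform`: continuous exact-Kerr escape fields on radial bands, with constants
# UNIFORM over a compact set of subextremal labels `ℓ = (M, a)`
(crux `GapExhaustion`, stmt-FinalStateConjecture-10808, line photon-shell-pseudoconvexity;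
stub (UE-1b) `stub_kerrEscapeFieldsContinuousU`, the label-uniform twin of the per-label brick
`stub_kerrEscapeFieldsContinuous` of
`BartnikGapSettlingGapExhaustionKerrEscapeFieldsContinuous.lean`; lead c11, label-uniformity wave 1)

The registered outward Killing sweep S5 quantifies its constants BEFORE the Kerr label `(M, a)`,
over a compact window of subextremal labels, so the escape brick (E-1b) of §1f has to hold with
ONE triple `(m, ν, L)` for all labels `ℓ = (M, a)` of a compact `K ⊆ {0 < M, |a| < M}` and all
bands `r_lo(ℓ) ≤ r ≤ r_hi(ℓ)`, `r₊(ℓ) < r_lo(ℓ)`, `r_lo`, `r_hi` continuous on `K`: **for every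
`ℓ ∈ K` there are two vector fields `Y₁, Y₂`, continuous on the exterior `{r > r₊(ℓ)}`, with
`‖Yᵢ‖ ≤ L`, `g_ℓ(Yᵢ, Yᵢ) ≤ −m`, `g_ℓ(Y₁, Y₂) ≥ m` (opposite time-cones) and `dr(Yᵢ) ≥ ν` at every
point of the band of `ℓ` (all Kerr-star times).**

Witnesses: the explicit fields of the per-label brick at each label (`V = Kerr.timeVector =
−g♯dt*`, `W = Kerr.radiusGradVector = g♯dr`, `H = Mr/Σ`, `Δ = r² − 2Mr + a² > 0` beyond `r₊`):
`Y₂ = −V` and `Y₁ = V + (4Mr/Δ) W`, with `g(Yᵢ, Yᵢ) = −1 − 2H ≤ −1`,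
`g(Y₁, Y₂) = 1 + 2H + 8MrH/Δ ≥ 1`, `dr(Yᵢ) = 2H`. So `m = 1`; the rate `ν = inf 2H > 0` and the
bound `L = sup ‖Yᵢ‖` are taken over the compact LABELLED time slice
`S = {(ℓ, z) | ℓ ∈ K, z⁰ = 0, r_lo(ℓ) ≤ r_{ℓ.2}(z) ≤ r_hi(ℓ)}` (closed, inside the compact constant
slice of `stub_kerrBilin_coercive_exteriorU_isCompact_slice`), on which `2H`, `Y₁`, `Y₂` are
jointly continuous in `(ℓ, z)` (joint smoothness of `H`, `ℓ♯`, `g♯dr` in `(M, a, x)` on `{r > 0}`: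
`Kerr.contDiffAt_scalarH₃`, `Kerr.contDiffAt_nullVector₂`, `Kerr.contDiffAt_radiusSharp₃`) and
`H > 0`; the bounds are transported to all times by the stationarity of Kerr. (The pointwise
identities of (E-1b) are private to its module, so they are re-run here.)

References: R. P. Kerr, A. Schild (1965), §§2–3 [KerrSchild1965]; B. O'Neill, *The geometry of
Kerr black holes* (1995), §2.4–§2.5 (`Δ`, `grad r`) [ONeill1995]; M. Dafermos, I. Rodnianski,
arXiv:0811.0354, §5.1 (`V`) [arXiv08110354]; M. Visser, arXiv:0706.0622, (33)–(35)
[arXiv07060622].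
-/

noncomputable section

-- D-0017: single-problem summit, `Summit.<S>.<S>.…` by design (cf. lakefile `weak.linter.dupNamespace`).
set_option linter.dupNamespace false

namespace Summit.FinalStateConjecture.FinalStateConjecture.Theorems

open Set Literature.Geometry.Lorentzian
open scoped Manifold ContDiff Topology

/-! ### The compact labelled time slice of the bands -/

/-- The labelled time slice `{(ℓ, z) | ℓ ∈ K, z⁰ = 0, r_lo(ℓ) ≤ r_{ℓ.2}(z) ≤ r_hi(ℓ)}` of the bands
over a compact set `K` of labels, with `r_lo`, `r_hi` continuous on `K`, is compact: closed (the
Kerr–Schild radius is jointly continuous in `(a, x)`) and inside the compact constant slice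
`{ℓ ∈ K, z⁰ = 0, −B₀ ≤ r ≤ B₁}` (`stub_kerrBilin_coercive_exteriorU_isCompact_slice`), `B₀`, `B₁`
bounds of `|r_lo|`, `|r_hi|` on `K`. [cite: KerrSchild1965, §3] -/
theorem stub_kerrEscapeFieldsContinuousU_isCompact_slice {K : Set (ℝ × ℝ)}
    {r_lo r_hi : ℝ × ℝ → ℝ} (hK : IsCompact K) (hloc : ContinuousOn r_lo K)
    (hhic : ContinuousOn r_hi K) :
    IsCompact {q : (ℝ × ℝ) × E4 | q.1 ∈ K ∧ q.2 0 = 0 ∧ r_lo q.1 ≤ Kerr.radius q.1.2 q.2 ∧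
      Kerr.radius q.1.2 q.2 ≤ r_hi q.1} := by
  have hradc : Continuous fun q : (ℝ × ℝ) × E4 ↦ Kerr.radius q.1.2 q.2 :=
    stub_kerrBandHigherRegularityU_continuous_radius
  -- the closed set `S₀ = K × E4` of labelled points
  set S₀ : Set ((ℝ × ℝ) × E4) := {q | q.1 ∈ K} with hS₀def
  have hS₀ : IsClosed S₀ := hK.isClosed.preimage continuous_fst
  have hloS₀ : ContinuousOn (fun q : (ℝ × ℝ) × E4 ↦ r_lo q.1) S₀ :=
    hloc.comp continuous_fst.continuousOn fun q hq ↦ hq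
  have hhiS₀ : ContinuousOn (fun q : (ℝ × ℝ) × E4 ↦ r_hi q.1) S₀ :=
    hhic.comp continuous_fst.continuousOn fun q hq ↦ hq
  have h0 : IsClosed {q : (ℝ × ℝ) × E4 | q.2 0 = 0} :=
    isClosed_eq ((E4.dx 0).continuous.comp continuous_snd) continuous_const
  have h1 : IsClosed {q ∈ S₀ | r_lo q.1 ≤ Kerr.radius q.1.2 q.2} :=
    hS₀.isClosed_le hloS₀ hradc.continuousOn
  have h2 : IsClosed {q ∈ S₀ | Kerr.radius q.1.2 q.2 ≤ r_hi q.1} :=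
    hS₀.isClosed_le hradc.continuousOn hhiS₀
  have hclosed : IsClosed {q : (ℝ × ℝ) × E4 | q.1 ∈ K ∧ q.2 0 = 0 ∧
      r_lo q.1 ≤ Kerr.radius q.1.2 q.2 ∧ Kerr.radius q.1.2 q.2 ≤ r_hi q.1} := by
    have hSeq : {q : (ℝ × ℝ) × E4 | q.1 ∈ K ∧ q.2 0 = 0 ∧
        r_lo q.1 ≤ Kerr.radius q.1.2 q.2 ∧ Kerr.radius q.1.2 q.2 ≤ r_hi q.1} =
        {q : (ℝ × ℝ) × E4 | q.2 0 = 0} ∩ ({q ∈ S₀ | r_lo q.1 ≤ Kerr.radius q.1.2 q.2} ∩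
          {q ∈ S₀ | Kerr.radius q.1.2 q.2 ≤ r_hi q.1}) := by
      ext q
      simp only [hS₀def, mem_setOf_eq, mem_inter_iff]
      tauto
    rw [hSeq]
    exact h0.inter (h1.inter h2)
  -- inside the compact constant slice `{ℓ ∈ K, z⁰ = 0, -B₀ ≤ r ≤ B₁}`
  obtain ⟨B₀, hB₀⟩ := hK.exists_bound_of_continuousOn hloc
  obtain ⟨B₁, hB₁⟩ := hK.exists_bound_of_continuousOn hhic
  refine (stub_kerrBilin_coercive_exteriorU_isCompact_slice hK (-B₀) B₁).of_isClosed_subset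
    hclosed ?_
  intro q hq
  obtain ⟨hℓ, hx0, hlo, hhi⟩ := hq
  refine ⟨hℓ, hx0, ?_, hhi.trans ((Real.le_norm_self _).trans (hB₁ q.1 hℓ))⟩
  have h := hB₀ q.1 hℓ
  rw [Real.norm_eq_abs] at h
  exact (abs_le.1 h).1.trans hlo

/-! ### The Kerr ingredients, jointly in the label: `H`, `V`, `W = g♯dr` -/

/-- `(M, a, x) ↦ H = Mr³/(r⁴ + a²z²)` is jointly continuous in the labelled point where `r > 0`
(`Kerr.contDiffAt_scalarH₃`). [cite: KerrSchild1965, §3] -/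
theorem stub_kerrEscapeFieldsContinuousU_continuousAt_scalarH {q : (ℝ × ℝ) × E4}
    (hq : 0 < Kerr.radius q.1.2 q.2) :
    ContinuousAt (fun q : (ℝ × ℝ) × E4 ↦ Kerr.scalarH q.1.1 q.1.2 q.2) q := by
  have h := (Kerr.contDiffAt_scalarH₃ (n := 0) (q := (q.1.1, q.1.2, q.2)) hq).comp q
    (contDiffAt_fst.fst.prodMk (contDiffAt_fst.snd.prodMk contDiffAt_snd))
  exact h.continuousAt

/-- `(M, a, x) ↦ V = ∂₀ − 2H ℓ♯` (`V = −g♯dt*`, `Kerr.timeVector`) is jointly continuous in the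
labelled point where `r > 0` (`H` and `ℓ♯` are jointly smooth there). Dafermos–Rodnianski
arXiv:0811.0354, §5.1. [cite: arXiv08110354, §5.1] -/
theorem stub_kerrEscapeFieldsContinuousU_continuousAt_timeVector {q : (ℝ × ℝ) × E4}
    (hq : 0 < Kerr.radius q.1.2 q.2) :
    ContinuousAt (fun q : (ℝ × ℝ) × E4 ↦ Kerr.timeVector q.1.1 q.1.2 q.2) q := by
  have hH := stub_kerrEscapeFieldsContinuousU_continuousAt_scalarH hq
  have hl : ContinuousAt (fun q : (ℝ × ℝ) × E4 ↦ Kerr.nullVector q.1.2 q.2) q := by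
    have h := (Kerr.contDiffAt_nullVector₂ (n := 0) (p := (q.1.2, q.2)) hq).comp q
      (contDiffAt_fst.snd.prodMk contDiffAt_snd)
    exact h.continuousAt
  unfold Kerr.timeVector
  exact continuousAt_const.sub ((continuousAt_const.mul hH).smul hl)

/-- `(M, a, x) ↦ g♯dr` (`Kerr.radiusGradVector`, which is the tree's `Kerr.radiusSharp`) is
jointly continuous in the labelled point where `r > 0` (`Kerr.contDiffAt_radiusSharp₃`).
[folklore] -/
theorem stub_kerrEscapeFieldsContinuousU_continuousAt_radiusGradVector {q : (ℝ × ℝ) × E4}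
    (hq : 0 < Kerr.radius q.1.2 q.2) :
    ContinuousAt (fun q : (ℝ × ℝ) × E4 ↦ Kerr.radiusGradVector q.1.1 q.1.2 q.2) q := by
  have e : (fun q : (ℝ × ℝ) × E4 ↦ Kerr.radiusGradVector q.1.1 q.1.2 q.2) =
      fun q : (ℝ × ℝ) × E4 ↦ Kerr.radiusSharp q.1.1 q.1.2 q.2 := rfl
  rw [e]
  have h := (Kerr.contDiffAt_radiusSharp₃ (n := 0) (q := (q.1.1, q.1.2, q.2)) hq).comp q
    (contDiffAt_fst.fst.prodMk (contDiffAt_fst.snd.prodMk contDiffAt_snd))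
  exact h.continuousAt

/-- `g♯dr` is invariant under Kerr-star time translations (Kerr is stationary).
[cite: ONeill1995, §2.5] -/
theorem stub_kerrEscapeFieldsContinuousU_radiusGradVector_add_time (M a : ℝ) (z : E4) (t : ℝ) :
    Kerr.radiusGradVector M a (z + t • E4.basisVector 0) = Kerr.radiusGradVector M a z := by
  simp only [Kerr.radiusGradVector, Kerr.spatial_add_smul_basisVector_zero,
    Kerr.scalarH_add_smul_basisVector_zero, Kerr.nullVector_add_smul_basisVector_zero]

/-- `Δ(r) = r² − 2Mr + a² > 0` at points with `r > r₊` of a subextremal Kerr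
(`Δ = (r − r₊)(r − r₋)`). [cite: ONeill1995, §2.4] -/
private theorem stub_kerrEscapeFieldsContinuousU_delta_pos {M a : ℝ} (ha : |a| < M) {z : E4}
    (hz : Kerr.rPlus M a < Kerr.radius a z) :
    0 < Kerr.radius a z ^ 2 - 2 * M * Kerr.radius a z + a ^ 2 := by
  have hsub : Kerr.IsSubextremal M a := ha
  rw [← Kerr.sub_rPlus_mul_sub_rMinus hsub.sq_lt_sq.le]
  exact Kerr.sub_rPlus_mul_sub_rMinus_pos hz

/-- `H = Mr³/(r⁴ + a²z²) > 0` for `M > 0` wherever `r > 0`. [cite: arXiv07060622, (33)] -/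
private theorem stub_kerrEscapeFieldsContinuousU_scalarH_pos {M a : ℝ} (hM : 0 < M) {z : E4}
    (hz : 0 < Kerr.radius a z) : 0 < Kerr.scalarH M a z := by
  unfold Kerr.scalarH
  positivity

/-! ### The pointwise identities for `Y₁ = V + (4Mr/Δ) W` and `Y₂ = −V` -/

/-- `g(−V, −V) = −1 − 2H`. [cite: arXiv08110354, §5.1] -/
private theorem stub_kerrEscapeFieldsContinuousU_bilin_Y₂_Y₂ {M a : ℝ} {z : E4}
    (hz : 0 < Kerr.radius a z) :
    Kerr.bilin M a z (-Kerr.timeVector M a z) (-Kerr.timeVector M a z) =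
      -1 - 2 * Kerr.scalarH M a z := by
  simp only [map_neg, neg_apply, neg_neg]
  exact Kerr.bilin_timeVector_timeVector hz

/-- `dr(−V) = g(W, −V) = 2H`. [cite: ONeill1995, §2.5] -/
private theorem stub_kerrEscapeFieldsContinuousU_dr_Y₂ {M a : ℝ} {z : E4}
    (hz : 0 < Kerr.radius a z) :
    fderiv ℝ (Kerr.radius a) z (-Kerr.timeVector M a z) = 2 * Kerr.scalarH M a z := by
  rw [(Kerr.hasFDerivAt_radius_bilin (M := M) hz).fderiv, map_neg, Kerr.bilin_symm,
    Kerr.bilin_timeVector_radiusGradVector hz, neg_neg]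

/-- `g(Y₁, Y₁) = −1 − 2H` for `Y₁ = V + (4Mr/Δ) W` (`g(V,V) = −1 − 2H`, `g(V,W) = −2H`,
`g(W,W) = Δ/Σ`, `HΣ = Mr`). [cite: ONeill1995, §2.5] -/
private theorem stub_kerrEscapeFieldsContinuousU_bilin_Y₁_Y₁ {M a : ℝ} {z : E4}
    (hz : 0 < Kerr.radius a z) (hΔ : Kerr.radius a z ^ 2 - 2 * M * Kerr.radius a z + a ^ 2 ≠ 0) :
    Kerr.bilin M a z
        (Kerr.timeVector M a z + (4 * M * Kerr.radius a z /
          (Kerr.radius a z ^ 2 - 2 * M * Kerr.radius a z + a ^ 2)) • Kerr.radiusGradVector M a z)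
        (Kerr.timeVector M a z + (4 * M * Kerr.radius a z /
          (Kerr.radius a z ^ 2 - 2 * M * Kerr.radius a z + a ^ 2)) • Kerr.radiusGradVector M a z) =
      -1 - 2 * Kerr.scalarH M a z := by
  have hS : 0 < Kerr.blSigma a (E4.spatial z) := Kerr.blSigma_spatial_pos hz
  simp only [map_add, map_smul, add_apply, smul_apply, smul_eq_mul]
  rw [Kerr.bilin_timeVector_timeVector hz, Kerr.bilin_timeVector_radiusGradVector hz,
    Kerr.bilin_symm M a z (Kerr.radiusGradVector M a z) (Kerr.timeVector M a z),
    Kerr.bilin_timeVector_radiusGradVector hz, Kerr.bilin_radiusGradVector_self hz,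
    Kerr.scalarH_eq_div_blSigma M a hz]
  -- `Δ` as an independent atom: the identity holds for rational functions of `(M, r, Σ, Δ)`
  generalize Kerr.radius a z ^ 2 - 2 * M * Kerr.radius a z + a ^ 2 = D at hΔ ⊢
  field_simp
  ring

/-- `g(Y₁, −V) = 1 + 2H + (4Mr/Δ)(2H)` for `Y₁ = V + (4Mr/Δ) W`. [cite: ONeill1995, §2.5] -/
private theorem stub_kerrEscapeFieldsContinuousU_bilin_Y₁_Y₂ {M a : ℝ} {z : E4}
    (hz : 0 < Kerr.radius a z) :
    Kerr.bilin M a z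
        (Kerr.timeVector M a z + (4 * M * Kerr.radius a z /
          (Kerr.radius a z ^ 2 - 2 * M * Kerr.radius a z + a ^ 2)) • Kerr.radiusGradVector M a z)
        (-Kerr.timeVector M a z) =
      1 + 2 * Kerr.scalarH M a z + (4 * M * Kerr.radius a z /
          (Kerr.radius a z ^ 2 - 2 * M * Kerr.radius a z + a ^ 2)) * (2 * Kerr.scalarH M a z) := by
  simp only [map_add, map_smul, map_neg, add_apply, smul_apply, smul_eq_mul]
  rw [Kerr.bilin_timeVector_timeVector hz,
    Kerr.bilin_symm M a z (Kerr.radiusGradVector M a z) (Kerr.timeVector M a z),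
    Kerr.bilin_timeVector_radiusGradVector hz]
  ring

/-- `dr(Y₁) = g(W, V) + (4Mr/Δ) g(W, W) = −2H + 4Mr/Σ = 2H` for `Y₁ = V + (4Mr/Δ) W`.
[cite: ONeill1995, §2.5] -/
private theorem stub_kerrEscapeFieldsContinuousU_dr_Y₁ {M a : ℝ} {z : E4}
    (hz : 0 < Kerr.radius a z) (hΔ : Kerr.radius a z ^ 2 - 2 * M * Kerr.radius a z + a ^ 2 ≠ 0) :
    fderiv ℝ (Kerr.radius a) z
        (Kerr.timeVector M a z + (4 * M * Kerr.radius a z /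
          (Kerr.radius a z ^ 2 - 2 * M * Kerr.radius a z + a ^ 2)) • Kerr.radiusGradVector M a z) =
      2 * Kerr.scalarH M a z := by
  have hS : 0 < Kerr.blSigma a (E4.spatial z) := Kerr.blSigma_spatial_pos hz
  rw [(Kerr.hasFDerivAt_radius_bilin (M := M) hz).fderiv, map_add, map_smul, smul_eq_mul,
    Kerr.bilin_symm M a z (Kerr.radiusGradVector M a z) (Kerr.timeVector M a z),
    Kerr.bilin_timeVector_radiusGradVector hz, Kerr.bilin_radiusGradVector_self hz,
    Kerr.scalarH_eq_div_blSigma M a hz]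
  generalize Kerr.radius a z ^ 2 - 2 * M * Kerr.radius a z + a ^ 2 = D at hΔ ⊢
  field_simp
  ring

/-! ### The uniform escape fields -/

/-- **(UE-1b) Continuous exact-Kerr escape fields on radial bands, with constants uniform over a
compact set of subextremal labels (crux `GapExhaustion`, stmt-FinalStateConjecture-10808; line
photon-shell-pseudoconvexity, §1f ESCAPE, label-uniform form of (E-1b)
`stub_kerrEscapeFieldsContinuous`).** For a compact `K ⊆ {(M, a) | 0 < M, |a| < M}` and band radii
`r_lo r_hi` continuous on `K` with `r₊(ℓ) < r_lo(ℓ) ≤ r_hi(ℓ)` there are `m, ν, L > 0` such that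
for every `ℓ = (M, a) ∈ K` there are two vector fields `Y₁, Y₂`, continuous on the exterior
`{r > r₊(ℓ)}`, with, at every point `z` with `r_lo(ℓ) ≤ r_a(z) ≤ r_hi(ℓ)` (all times):
`‖Yᵢ z‖ ≤ L`, `g_z(Yᵢ, Yᵢ) ≤ −m`, `g_z(Y₁, Y₂) ≥ m` (opposite time-cones) and `dr_z(Yᵢ) ≥ ν`.
Witnesses `Y₂ = −V`, `Y₁ = V + (4Mr/Δ) g♯dr` with `V = −g♯dt*` at each label
(Dafermos–Rodnianski arXiv:0811.0354, §5.1; O'Neill 1995, §2.5): `m = 1`, `ν = inf 2H`,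
`L = sup ‖Yᵢ‖` over the compact labelled time slice of the bands (joint continuity of `H`, `V`,
`g♯dr` in `(M, a, x)` on `{r > 0}`, Kerr–Schild 1965, §3), transported to all times by
stationarity. [cite: KerrSchild1965, §3] -/
theorem stub_kerrEscapeFieldsContinuousU :
    ∀ (K : Set (ℝ × ℝ)) (r_lo r_hi : ℝ × ℝ → ℝ), IsCompact K →
      (∀ ℓ ∈ K, 0 < ℓ.1 ∧ |ℓ.2| < ℓ.1) → ContinuousOn r_lo K → ContinuousOn r_hi K →
      (∀ ℓ ∈ K, Kerr.rPlus ℓ.1 ℓ.2 < r_lo ℓ ∧ r_lo ℓ ≤ r_hi ℓ) →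
      ∃ (m ν L : ℝ), 0 < m ∧ 0 < ν ∧ 0 < L ∧ ∀ ℓ ∈ K,
      ∃ (Y₁ Y₂ : E4 → E4),
        ContinuousOn Y₁ {z : E4 | Kerr.rPlus ℓ.1 ℓ.2 < Kerr.radius ℓ.2 z} ∧
        ContinuousOn Y₂ {z : E4 | Kerr.rPlus ℓ.1 ℓ.2 < Kerr.radius ℓ.2 z} ∧
        ∀ z : E4, r_lo ℓ ≤ Kerr.radius ℓ.2 z → Kerr.radius ℓ.2 z ≤ r_hi ℓ →
          ‖Y₁ z‖ ≤ L ∧ ‖Y₂ z‖ ≤ L ∧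
          Kerr.bilin ℓ.1 ℓ.2 z (Y₁ z) (Y₁ z) ≤ -m ∧ Kerr.bilin ℓ.1 ℓ.2 z (Y₂ z) (Y₂ z) ≤ -m ∧
          m ≤ Kerr.bilin ℓ.1 ℓ.2 z (Y₁ z) (Y₂ z) ∧
          ν ≤ fderiv ℝ (Kerr.radius ℓ.2) z (Y₁ z) ∧ ν ≤ fderiv ℝ (Kerr.radius ℓ.2) z (Y₂ z) := by
  intro K r_lo r_hi hK hKsub hloc hhic hband
  -- per label: `0 < r₊(ℓ) < r_lo(ℓ)`, so band points are exterior points and have `r > 0`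
  have hrp : ∀ ℓ ∈ K, 0 < Kerr.rPlus ℓ.1 ℓ.2 := fun ℓ hℓ ↦
    Kerr.IsSubextremal.rPlus_pos (M := ℓ.1) (a := ℓ.2) (hKsub ℓ hℓ).2
  have hext : ∀ ℓ ∈ K, ∀ z : E4, r_lo ℓ ≤ Kerr.radius ℓ.2 z →
      Kerr.rPlus ℓ.1 ℓ.2 < Kerr.radius ℓ.2 z := fun ℓ hℓ z hz ↦ (hband ℓ hℓ).1.trans_le hz
  have hext0 : ∀ ℓ ∈ K, ∀ z : E4, Kerr.rPlus ℓ.1 ℓ.2 < Kerr.radius ℓ.2 z →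
      0 < Kerr.radius ℓ.2 z := fun ℓ hℓ z hz ↦ (hrp ℓ hℓ).trans hz
  -- abbreviations: `Δ`, the two fields, at each label
  set Δ : ℝ × ℝ → E4 → ℝ := fun ℓ z ↦
    Kerr.radius ℓ.2 z ^ 2 - 2 * ℓ.1 * Kerr.radius ℓ.2 z + ℓ.2 ^ 2 with hΔdef
  set Y₁ : ℝ × ℝ → E4 → E4 := fun ℓ z ↦ Kerr.timeVector ℓ.1 ℓ.2 z +
    (4 * ℓ.1 * Kerr.radius ℓ.2 z / Δ ℓ z) • Kerr.radiusGradVector ℓ.1 ℓ.2 z with hY₁def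
  set Y₂ : ℝ × ℝ → E4 → E4 := fun ℓ z ↦ -Kerr.timeVector ℓ.1 ℓ.2 z with hY₂def
  have hΔpos : ∀ ℓ ∈ K, ∀ z : E4, Kerr.rPlus ℓ.1 ℓ.2 < Kerr.radius ℓ.2 z → 0 < Δ ℓ z :=
    fun ℓ hℓ z hz ↦ stub_kerrEscapeFieldsContinuousU_delta_pos (hKsub ℓ hℓ).2 hz
  -- joint continuity of the two fields in the labelled point, at exterior points
  have hradc : Continuous fun q : (ℝ × ℝ) × E4 ↦ Kerr.radius q.1.2 q.2 :=
    stub_kerrBandHigherRegularityU_continuous_radius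
  have hY₁c : ∀ ℓ ∈ K, ∀ z : E4, Kerr.rPlus ℓ.1 ℓ.2 < Kerr.radius ℓ.2 z →
      ContinuousAt (fun q : (ℝ × ℝ) × E4 ↦ Y₁ q.1 q.2) (ℓ, z) := by
    intro ℓ hℓ z hzext
    have hz : 0 < Kerr.radius ℓ.2 z := hext0 ℓ hℓ z hzext
    have hV : ContinuousAt (fun q : (ℝ × ℝ) × E4 ↦ Kerr.timeVector q.1.1 q.1.2 q.2) (ℓ, z) :=
      stub_kerrEscapeFieldsContinuousU_continuousAt_timeVector (q := (ℓ, z)) hz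
    have hW : ContinuousAt (fun q : (ℝ × ℝ) × E4 ↦ Kerr.radiusGradVector q.1.1 q.1.2 q.2) (ℓ, z) :=
      stub_kerrEscapeFieldsContinuousU_continuousAt_radiusGradVector (q := (ℓ, z)) hz
    have hr : ContinuousAt (fun q : (ℝ × ℝ) × E4 ↦ Kerr.radius q.1.2 q.2) (ℓ, z) :=
      hradc.continuousAt
    have hM : ContinuousAt (fun q : (ℝ × ℝ) × E4 ↦ q.1.1) (ℓ, z) := continuousAt_fst.fst
    have ha : ContinuousAt (fun q : (ℝ × ℝ) × E4 ↦ q.1.2) (ℓ, z) := continuousAt_fst.snd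
    have hc : ContinuousAt (fun q : (ℝ × ℝ) × E4 ↦ 4 * q.1.1 * Kerr.radius q.1.2 q.2 /
        (Kerr.radius q.1.2 q.2 ^ 2 - 2 * q.1.1 * Kerr.radius q.1.2 q.2 + q.1.2 ^ 2)) (ℓ, z) :=
      ((continuousAt_const.mul hM).mul hr).div
        (((hr.pow 2).sub ((continuousAt_const.mul hM).mul hr)).add (ha.pow 2))
        (hΔpos ℓ hℓ z hzext).ne'
    simp only [hY₁def, hΔdef]
    exact hV.add (hc.smul hW)
  have hY₂c : ∀ ℓ ∈ K, ∀ z : E4, Kerr.rPlus ℓ.1 ℓ.2 < Kerr.radius ℓ.2 z →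
      ContinuousAt (fun q : (ℝ × ℝ) × E4 ↦ Y₂ q.1 q.2) (ℓ, z) := by
    intro ℓ hℓ z hzext
    simp only [hY₂def]
    exact (stub_kerrEscapeFieldsContinuousU_continuousAt_timeVector (q := (ℓ, z))
      (hext0 ℓ hℓ z hzext)).neg
  -- the embedding of the points of one label into the labelled points
  have hemb : ∀ ℓ : ℝ × ℝ, Continuous fun z : E4 ↦ ((ℓ, z) : (ℝ × ℝ) × E4) := fun ℓ ↦
    continuous_const.prodMk continuous_id
  -- the compact labelled time slice of the bands; its points are exterior points of their label
  set S : Set ((ℝ × ℝ) × E4) := {q | q.1 ∈ K ∧ q.2 0 = 0 ∧ r_lo q.1 ≤ Kerr.radius q.1.2 q.2 ∧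
    Kerr.radius q.1.2 q.2 ≤ r_hi q.1} with hSdef
  have hS : IsCompact S := stub_kerrEscapeFieldsContinuousU_isCompact_slice hK hloc hhic
  have hSext : ∀ q ∈ S, Kerr.rPlus q.1.1 q.1.2 < Kerr.radius q.1.2 q.2 := fun q hq ↦
    hext q.1 hq.1 q.2 hq.2.2.1
  -- the rate `ν = inf_S 2H > 0` (`H > 0` for `M > 0`, `r > 0`) and the bounds `Bᵢ = sup_S ‖Yᵢ‖`
  obtain ⟨ν, hν, hνS⟩ : ∃ ν : ℝ, 0 < ν ∧ ∀ q ∈ S, ν ≤ 2 * Kerr.scalarH q.1.1 q.1.2 q.2 :=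
    hS.exists_forall_le' (f := fun q : (ℝ × ℝ) × E4 ↦ 2 * Kerr.scalarH q.1.1 q.1.2 q.2)
      (fun q hq ↦ (continuousAt_const.mul (stub_kerrEscapeFieldsContinuousU_continuousAt_scalarH
        (hext0 q.1 hq.1 q.2 (hSext q hq)))).continuousWithinAt)
      fun q hq ↦ mul_pos two_pos (stub_kerrEscapeFieldsContinuousU_scalarH_pos (hKsub q.1 hq.1).1
        (hext0 q.1 hq.1 q.2 (hSext q hq)))
  have hY₁S : ContinuousOn (fun q : (ℝ × ℝ) × E4 ↦ Y₁ q.1 q.2) S := fun q hq ↦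
    (hY₁c q.1 hq.1 q.2 (hSext q hq)).continuousWithinAt
  have hY₂S : ContinuousOn (fun q : (ℝ × ℝ) × E4 ↦ Y₂ q.1 q.2) S := fun q hq ↦
    (hY₂c q.1 hq.1 q.2 (hSext q hq)).continuousWithinAt
  obtain ⟨B₁, hB₁⟩ := hS.exists_bound_of_continuousOn hY₁S
  obtain ⟨B₂, hB₂⟩ := hS.exists_bound_of_continuousOn hY₂S
  refine ⟨1, ν, max (max B₁ B₂) 1, one_pos, hν, lt_max_of_lt_right one_pos, fun ℓ hℓ ↦
    ⟨Y₁ ℓ, Y₂ ℓ,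
    fun z hz ↦ ((hY₁c ℓ hℓ z hz).comp_of_eq (hemb ℓ).continuousAt rfl).continuousWithinAt,
    fun z hz ↦ ((hY₂c ℓ hℓ z hz).comp_of_eq (hemb ℓ).continuousAt rfl).continuousWithinAt,
    fun z hz₁ hz₂ ↦ ?_⟩⟩
  have hzext : Kerr.rPlus ℓ.1 ℓ.2 < Kerr.radius ℓ.2 z := hext ℓ hℓ z hz₁
  have hz : 0 < Kerr.radius ℓ.2 z := hext0 ℓ hℓ z hzext
  have hM : 0 < ℓ.1 := (hKsub ℓ hℓ).1
  -- translate `z` to the time slice, `z - z⁰ ∂₀ ∈ S`: Kerr is stationary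
  have hrad' : Kerr.radius ℓ.2 (z + (-z 0) • E4.basisVector 0) = Kerr.radius ℓ.2 z :=
    Kerr.radius_add_time_smul_basisVector ℓ.2 z _
  have hmem : (ℓ, z + (-z 0) • E4.basisVector 0) ∈ S := by
    refine ⟨hℓ, ?_, ?_, ?_⟩
    · show (z + (-z 0) • E4.basisVector 0) 0 = 0
      simp [E4.basisVector]
    · show r_lo ℓ ≤ Kerr.radius ℓ.2 (z + (-z 0) • E4.basisVector 0)
      rwa [hrad']
    · show Kerr.radius ℓ.2 (z + (-z 0) • E4.basisVector 0) ≤ r_hi ℓ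
      rwa [hrad']
  have hY₁' : Y₁ ℓ (z + (-z 0) • E4.basisVector 0) = Y₁ ℓ z := by
    simp only [hY₁def, hΔdef, Kerr.timeVector_add_smul_basisVector_zero,
      Kerr.radius_add_time_smul_basisVector,
      stub_kerrEscapeFieldsContinuousU_radiusGradVector_add_time]
  have hY₂' : Y₂ ℓ (z + (-z 0) • E4.basisVector 0) = Y₂ ℓ z := by
    simp only [hY₂def, Kerr.timeVector_add_smul_basisVector_zero]
  have hνz : ν ≤ 2 * Kerr.scalarH ℓ.1 ℓ.2 z := by
    have h : ν ≤ 2 * Kerr.scalarH ℓ.1 ℓ.2 (z + (-z 0) • E4.basisVector 0) :=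
      hνS (ℓ, z + (-z 0) • E4.basisVector 0) hmem
    rwa [Kerr.scalarH_add_smul_basisVector_zero] at h
  have hL₁ : ‖Y₁ ℓ z‖ ≤ max (max B₁ B₂) 1 := by
    have h : ‖Y₁ ℓ (z + (-z 0) • E4.basisVector 0)‖ ≤ B₁ :=
      hB₁ (ℓ, z + (-z 0) • E4.basisVector 0) hmem
    rw [hY₁'] at h
    exact h.trans ((le_max_left _ _).trans (le_max_left _ _))
  have hL₂ : ‖Y₂ ℓ z‖ ≤ max (max B₁ B₂) 1 := by
    have h : ‖Y₂ ℓ (z + (-z 0) • E4.basisVector 0)‖ ≤ B₂ :=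
      hB₂ (ℓ, z + (-z 0) • E4.basisVector 0) hmem
    rw [hY₂'] at h
    exact h.trans ((le_max_right _ _).trans (le_max_left _ _))
  -- the pointwise identities
  have hΔz : Kerr.radius ℓ.2 z ^ 2 - 2 * ℓ.1 * Kerr.radius ℓ.2 z + ℓ.2 ^ 2 ≠ 0 :=
    (hΔpos ℓ hℓ z hzext).ne'
  have hH : 0 ≤ Kerr.scalarH ℓ.1 ℓ.2 z := Kerr.scalarH_nonneg hM.le ℓ.2 z
  have hc : 0 ≤ 4 * ℓ.1 * Kerr.radius ℓ.2 z /
      (Kerr.radius ℓ.2 z ^ 2 - 2 * ℓ.1 * Kerr.radius ℓ.2 z + ℓ.2 ^ 2) :=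
    div_nonneg (by positivity) (hΔpos ℓ hℓ z hzext).le
  refine ⟨hL₁, hL₂, ?_, ?_, ?_, ?_, ?_⟩
  · -- `g(Y₁, Y₁) = −1 − 2H ≤ −1`
    have h := stub_kerrEscapeFieldsContinuousU_bilin_Y₁_Y₁ hz hΔz
    simp only [hY₁def, hΔdef]
    rw [h]
    linarith
  · -- `g(Y₂, Y₂) = −1 − 2H ≤ −1`
    simp only [hY₂def]
    rw [stub_kerrEscapeFieldsContinuousU_bilin_Y₂_Y₂ hz]
    linarith
  · -- `g(Y₁, Y₂) = 1 + 2H + (4Mr/Δ) 2H ≥ 1`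
    simp only [hY₁def, hY₂def, hΔdef]
    rw [stub_kerrEscapeFieldsContinuousU_bilin_Y₁_Y₂ hz]
    nlinarith
  · -- `dr(Y₁) = 2H ≥ ν`
    have h := stub_kerrEscapeFieldsContinuousU_dr_Y₁ hz hΔz
    simp only [hY₁def, hΔdef]
    rw [h]
    exact hνz
  · -- `dr(Y₂) = 2H ≥ ν`
    simp only [hY₂def]
    rw [stub_kerrEscapeFieldsContinuousU_dr_Y₂ hz]
    exact hνz

end Summit.FinalStateConjecture.FinalStateConjecture.Theorems

end
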